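import Summits.Ventures.HSemireg.Pad4TowerLinePhaseRigidityUnits

/-!
# Pad4Tower ∕ LinePhaseRigidity — Part D THE ABSTRACT LINE MODEL: the presence predicates of any `G₁`-static effective LINE-`h` support satisfy the four closed forms of the toolkit read as propositional clauses on abstract cells; (OL_h) and the phase-type laws reduce to finite checks (`AbstractOddFree h`, …), monotone in `h`
# (HSemireg support file; PT-PORT-2 (a2), tree copy of control's crux workfile)

Crux of record: `Summit.HodgeConjecture.HodgeConjecture.Theses.EightfoldBlochSeeds.BlochSeedDiscOne` (= `HasHyperbolicBlochSeed 4 1`, item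
stmt-HodgeConjecture-18881; skeleton `Cruxes/BlochSeedDiscOne/Lines/birth.lean` 814a6a70c14e831a, STUB R `stub_rung_pad4_seedAt`, UNTOUCHED).
Nothing in this file proves HC, HC_AV, HC_CM, H2, item 18881, (T₈) or (T₁₀); census-neutral (no SAT∕UNSAT row is added or changed). Statements about
the typed FIRST-ORDER static game on the LINE alphabet of the PAD-4 design tower (`RuleDMu4Closed`, `XPlusClosed`, `G1Closed` of record) — H₁-static
letter DESIGNS, not sheaves, monads or seeds; HC_CM is a displayed binder of the ladder only, unused here.

PROVENANCE. TREE COPY — statements AND proofs verbatim; new are only the namespace `Summit.Ventures.HSemireg.Pad4Tower.LinePhaseRigidity`, this module docstring, the module boundary, the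
`import`∕`open` of the tree toolkit `Pad4TowerLineInertiaLetters`∕`…XPlus` (namespace `…Pad4Tower.LineInertia`, = the workfile's Part A + §C1, landed
separately under the same key) and one-line docstrings where the gate requires them — of Part D (§D1–§D4) of the crux workfile `Cruxes/BlochSeedDiscOne/LinePhaseRigidity.lean` v1.9 (author plan-lens-HodgeAV-control g9; crux commit f5c30e1c3066, sha16 f0ad6d2122a71d9c; critic plates idea-crit-6 g15 PASS). Filed in the tree on plan-lens-HodgeAV-control
g10's KEY (a2) (bus l.10147: «LinePhaseRigidity Parts B–F → tree, so that `DiamondLevelLaws.LineFloorDepth h` (∀ h) is a tree theorem») by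
hsemireg-phasetorus-typer-1 g3. Module set of (a2): `Pad4TowerLinePhaseRigidityUnits` (Parts B, C) → `Pad4TowerLinePhaseRigidityModel` (Part D) →
`Pad4TowerLinePhaseRigidityGap` (Parts E, F). 0 sorry, 0 named facts, no instance ∕ notation ∕ set_option ∕ native_decide; docstring on every declaration.

CONTENT. §D1 `ACell`, `realize`, `ACell.shift` (= Δ), realisation lemmas; §D2 **`structure LineModel h vN vP`** (support bound, apex-tag invariance, (RD-P),
(RD-N) ×2, (X+), `G₁`) and **`lineModel_of_config`** (SOUNDNESS: every `G₁`-closed RULE-D∕`X+`-closed effective LINE-`h` support yields a model on its presence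
predicates); §D3 the finite check `AbstractOddFree h`, `oddFCFreeLine_of_abstract`, monotonicity in `h`, the SAT-side bound from `Cert12`; §D4 the same reduction
for the phase-type laws (`AbstractPureFree`∕`AbstractAntipodalFree`, …).
-/

namespace Summit.Ventures.HSemireg.Pad4Tower.LinePhaseRigidity

open Finset Summit.Ventures.HSemireg.Pad4Tower Summit.Ventures.HSemireg.LinePhaseTorus Summit.Ventures.HSemireg.Pad4Tower.LineInertia

/-! # Part D — THE ABSTRACT LINE MODEL: (OL_h) and the odd threshold law reduce to ONE finite propositional check
(theorem first, computation second). The presence predicates of any `G₁`-static effective LINE-`h` support satisfy the four closed forms of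
Part A read as propositional clauses on abstract cells `(c_f, k_f)_f`; these clauses are EXACTLY what `oddline.py` ∕ `thresholds.py` feed to the
SAT solver (one variable per `G₁`-orbit = the quotient by `permN∕permP∕shiftN∕shiftP∕apexN∕apexP` below). The model is MONOTONE in `h`, so the
single check `AbstractOddFree 10` (machine: UNSAT, 5 352 orbit variables, 59 conflicts) implies the whole typed law `OddLineThresholdLaw`. -/

/-! ## §D1 Abstract LINE cells and their realisation -/

/-- an ABSTRACT LINE CELL: four abstract letters `(c, k)` — charge `c : ℕ` (`0` = apex, its tag immaterial) and phase tag `k : Fin 4`. -/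
abbrev ACell := Fin 4 → ℕ × Fin 4

/-- realisation at height `h`: `(c, k) ↦ lineLetter h c k = (h − c)·I + c·ℓ_{i^k}`. -/
def realize (h : ℤ) (X : ACell) : MCell := fun f => lineLetter h (X f).1 (X f).2

/-- `realize_apply` (Part D; tree copy, statement verbatim). -/
theorem realize_apply (h : ℤ) (X : ACell) (f : Fin 4) : realize h X f = lineLetter h (X f).1 (X f).2 := rfl

/-- realisation commutes with changing one letter. -/
theorem realize_update (h : ℤ) (X : ACell) (g : Fin 4) (c : ℕ) (k : Fin 4) :
    realize h (Function.update X g (c, k)) = Function.update (realize h X) g (lineLetter h c k) := by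
  funext f
  by_cases hf : f = g
  · subst hf; simp [realize]
  · simp [realize, Function.update_of_ne hf]

/-- the abstract SHIFT = `Δ`: every tag retarded by one. -/
def ACell.shift (X : ACell) : ACell := fun f => ((X f).1, (X f).2 + 3)

/-- `realize_shift` (Part D; tree copy, statement verbatim). -/
theorem realize_shift (h : ℤ) (X : ACell) : realize h X.shift = (realize h X).delta := by
  funext f
  simp only [realize, ACell.shift, MCell.delta, deltaPt_lineLetter]

/-- `realize_perm` (Part D; tree copy, statement verbatim). -/
theorem realize_perm (h : ℤ) (X : ACell) (σ : Equiv.Perm (Fin 4)) : realize h (fun f => X (σ f)) = MCell.perm σ (realize h X) := rfl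

/-- an abstract apex letter realises to the apex. -/
theorem realize_apex {h : ℤ} {X : ACell} {f : Fin 4} (hf : (X f).1 = 0) : realize h X f = (h, 0, 0) := by
  rw [realize_apply, hf, lineLetter_zero]

/-! ## §D2 The model axioms: support bound, apex-tag invariance, (RD-P), (RD-N) ×2, (X+), `G₁` -/

/-- **THE ABSTRACT LINE MODEL at height `h`** on presence predicates `vN` (lower level) and `vP` (upper level) of abstract cells: the four
closed forms of Part A as clauses (`rdP` = `p_up_server`, `rdN2` = `n_down_server`, `rdN1` = `n_hub_alternative`, `xplus` = `xplus_fires`), the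
support bound `2c ≤ h`, invariance under re-tagging apex letters, and `G₁`-invariance (`S₄` on factors, the shift `Δ`). -/
structure LineModel (h : ℤ) (vN vP : ACell → Prop) : Prop where
  boundN : ∀ X, vN X → ∀ f, 2 * ((X f).1 : ℤ) ≤ h
  boundP : ∀ X, vP X → ∀ f, 2 * ((X f).1 : ℤ) ≤ h
  apexN : ∀ X, vN X → ∀ g : Fin 4, ∀ k : Fin 4, (X g).1 = 0 → vN (Function.update X g (0, k))
  apexP : ∀ X, vP X → ∀ g : Fin 4, ∀ k : Fin 4, (X g).1 = 0 → vP (Function.update X g (0, k))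
  rdP : ∀ X, vP X → ∀ g : Fin 4, 1 ≤ (X g).1 → ∃ c' : ℕ, c' < (X g).1 ∧ vN (Function.update X g (c', (X g).2))
  rdN2 : ∀ X, vN X → ∀ g j : Fin 4, g ≠ j → 1 ≤ (X g).1 → 1 ≤ (X j).1 →
    ∃ c' : ℕ, (X g).1 < c' ∧ 2 * (c' : ℤ) ≤ h ∧ vP (Function.update X g (c', (X g).2))
  rdN1 : ∀ X, vN X → ∀ g j : Fin 4, g ≠ j → 1 ≤ (X g).1 → (X j).1 = 0 → ∀ k' : Fin 4,
    (∃ c' : ℕ, (X g).1 < c' ∧ 2 * (c' : ℤ) ≤ h ∧ vP (Function.update X g (c', (X g).2))) ∨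
    (∃ d : ℕ, ∃ p : Fin 4, 1 ≤ d ∧ p ≠ k' ∧ vP (Function.update X j (d, p))) ∨
    (∃ c' d : ℕ, ∃ p : Fin 4, (X g).1 < c' ∧ 2 * (c' : ℤ) ≤ h ∧ 1 ≤ d ∧ p ≠ k' ∧
      vP (Function.update (Function.update X g (c', (X g).2)) j (d, p)))
  xplus : ∀ X, vP X → ∀ σ f : Fin 4, f ≠ σ → 1 ≤ (X σ).1 → (X f).1 = 0 →
    vN (Function.update X σ (0, 0)) →
    (∀ c' : ℕ, 1 ≤ c' → c' < (X σ).1 → ¬ vN (Function.update X σ (c', (X σ).2))) →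
    ∀ e : ℕ, ∀ k'' : Fin 4, k'' ≠ (X σ).2 → 1 ≤ e → vP (Function.update X σ (e, k'')) →
    (∀ e' : ℕ, 1 ≤ e' → e' < e → ¬ vN (Function.update X σ (e', k''))) → False
  permN : ∀ X, vN X → ∀ σ : Equiv.Perm (Fin 4), vN (fun f => X (σ f))
  permP : ∀ X, vP X → ∀ σ : Equiv.Perm (Fin 4), vP (fun f => X (σ f))
  shiftN : ∀ X, vN X → vN X.shift
  shiftP : ∀ X, vP X → vP X.shift

/-- the model is MONOTONE in the height: the bound and the `2c' ≤ h` side conditions only weaken. -/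
theorem LineModel.mono {h h' : ℤ} (hle : h ≤ h') {vN vP : ACell → Prop} (M : LineModel h vN vP) : LineModel h' vN vP where
  boundN X hX f := le_trans (M.boundN X hX f) hle
  boundP X hX f := le_trans (M.boundP X hX f) hle
  apexN := M.apexN
  apexP := M.apexP
  rdP := M.rdP
  rdN2 X hX g j hgj hg hj := by
    obtain ⟨c', h1, h2, h3⟩ := M.rdN2 X hX g j hgj hg hj
    exact ⟨c', h1, le_trans h2 hle, h3⟩
  rdN1 X hX g j hgj hg hj k' := by
    rcases M.rdN1 X hX g j hgj hg hj k' with ⟨c', h1, h2, h3⟩ | ⟨d, p, h1, h2, h3⟩ | ⟨c', d, p, h1, h2, h3, h4, h5⟩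
    · exact Or.inl ⟨c', h1, le_trans h2 hle, h3⟩
    · exact Or.inr (Or.inl ⟨d, p, h1, h2, h3⟩)
    · exact Or.inr (Or.inr ⟨c', d, p, h1, le_trans h2 hle, h3, h4, h5⟩)
  xplus := M.xplus
  permN := M.permN
  permP := M.permP
  shiftN := M.shiftN
  shiftP := M.shiftP

/-- the charge of an effective LINE letter is determined by the letter. -/
theorem charge_eq_of_lineLetter_eq {h : ℤ} {c c' : ℕ} {k k' : Fin 4} (e : lineLetter h c k = lineLetter h c' k') : c = c' := by
  have h1 := congrArg Prod.fst e
  rw [lineLetter_fst, lineLetter_fst] at h1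
  omega

/-- **SOUNDNESS: the presence predicates of a `G₁`-static effective LINE-`h` support are an abstract LINE model at height `h`.**
(Each axiom is one of the PROVED closed forms of Part A, or `G₁`-closedness, transported along `realize`.) -/
theorem lineModel_of_config {h : ℤ} {C : MConfig} (hC : LSupport h C) (hG : C.G1Closed) (hD : RuleDMu4Closed C) (hX : XPlusClosed C) :
    LineModel h (fun X => realize h X ∈ C.lower) (fun X => realize h X ∈ C.upper) where
  boundN X hXm f := by
    obtain ⟨c, k, hc, e⟩ := hC.1 _ hXm f
    rw [realize_apply] at e
    rw [charge_eq_of_lineLetter_eq e]; exact hc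
  boundP X hXm f := by
    obtain ⟨c, k, hc, e⟩ := hC.2 _ hXm f
    rw [realize_apply] at e
    rw [charge_eq_of_lineLetter_eq e]; exact hc
  apexN X hXm g k hg := by
    show realize h (Function.update X g (0, k)) ∈ C.lower
    rw [realize_update, lineLetter_zero, ← realize_apex (X := X) hg, Function.update_eq_self]
    exact hXm
  apexP X hXm g k hg := by
    show realize h (Function.update X g (0, k)) ∈ C.upper
    rw [realize_update, lineLetter_zero, ← realize_apex (X := X) hg, Function.update_eq_self]
    exact hXm
  rdP X hXm g hg := by
    obtain ⟨N, hN, c', hc', hNe⟩ := p_up_server hC.1 (hC.2 _ hXm) (hD.2 _ hXm) (realize_apply h X g) hg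
    refine ⟨c', hc', ?_⟩
    show realize h (Function.update X g (c', (X g).2)) ∈ C.lower
    rw [realize_update, ← hNe]; exact hN
  rdN2 X hXm g j hgj hg hj := by
    obtain ⟨P, hP, c', h1, h2, hPe⟩ :=
      n_down_server hC.2 (hD.1 _ hXm) hgj (realize_apply h X g) hg (realize_apply h X j) hj
    refine ⟨c', h1, h2, ?_⟩
    show realize h (Function.update X g (c', (X g).2)) ∈ C.upper
    rw [realize_update, ← hPe]; exact hP
  rdN1 X hXm g j hgj hg hj k' := by
    have hja : isApex (realize h X j) := by
      rw [realize_apex (X := X) hj]; simp [isApex]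
    rcases n_hub_alternative hC.2 (hC.1 _ hXm) (hD.1 _ hXm) hgj (realize_apply h X g) hg hja k' with
      ⟨P, hP, c', h1, h2, hPe⟩ | ⟨P, hP, d, p, h1, h2, hPe⟩ | ⟨P, hP, c', d, p, h1, h2, h3, h4, hPe⟩
    · refine Or.inl ⟨c', h1, h2, ?_⟩
      show realize h (Function.update X g (c', (X g).2)) ∈ C.upper
      rw [realize_update, ← hPe]; exact hP
    · refine Or.inr (Or.inl ⟨d, p, h1, h2, ?_⟩)
      show realize h (Function.update X j (d, p)) ∈ C.upper
      rw [realize_update, ← hPe]; exact hP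
    · refine Or.inr (Or.inr ⟨c', d, p, h1, h2, h3, h4, ?_⟩)
      show realize h (Function.update (Function.update X g (c', (X g).2)) j (d, p)) ∈ C.upper
      rw [realize_update, realize_update, ← hPe]; exact hP
  xplus X hXm σ f hfσ hσ hf hN₀ htop e k'' hk'' he hsib hcomp := by
    have hN₀' : Function.update (realize h X) σ (h, 0, 0) ∈ C.lower := by
      have := hN₀; rwa [realize_update, lineLetter_zero] at this
    have htop' : ∀ c' : ℕ, 1 ≤ c' → c' < (X σ).1 →
        Function.update (realize h X) σ (lineLetter h c' (X σ).2) ∉ C.lower := by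
      intro c' h1 h2 hm
      exact htop c' h1 h2 (by show realize h _ ∈ C.lower; rwa [realize_update])
    have hsib' : Function.update (realize h X) σ (lineLetter h e k'') ∈ C.upper := by
      have := hsib; rwa [realize_update] at this
    have hcomp' : ∀ e' : ℕ, 1 ≤ e' → e' < e → Function.update (realize h X) σ (lineLetter h e' k'') ∉ C.lower := by
      intro e' h1 h2 hm
      exact hcomp e' h1 h2 (by show realize h _ ∈ C.lower; rwa [realize_update])
    exact xplus_fires hC.1 hXm hfσ (realize_apply h X σ) hσ (realize_apex (X := X) hf) hN₀' htop' hk'' he hsib' hcomp' hX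
  permN X hXm σ := by
    show realize h (fun f => X (σ f)) ∈ C.lower
    rw [realize_perm]; exact hG.1 σ _ hXm
  permP X hXm σ := by
    show realize h (fun f => X (σ f)) ∈ C.upper
    rw [realize_perm]; exact hG.2.1 σ _ hXm
  shiftN X hXm := by
    show realize h X.shift ∈ C.lower
    rw [realize_shift]; exact hG.2.2.1 _ hXm
  shiftP X hXm := by
    show realize h X.shift ∈ C.upper
    rw [realize_shift]; exact hG.2.2.2 _ hXm

/-! ## §D3 The finite check and the reduction theorems -/

/-- an abstract cell is FULLY CHARGED OF ODD PARITY WEIGHT: all charges `≥ 1` and an odd number of odd tags. -/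
def AOddFC (X : ACell) : Prop :=
  (∀ f, 1 ≤ (X f).1) ∧ ((X 0).2.val % 2 + (X 1).2.val % 2 + (X 2).2.val % 2 + (X 3).2.val % 2) % 2 = 1

/-- **(AOL_h) THE FINITE CHECK**: no abstract LINE model at height `h` makes an odd fully charged abstract cell present (on either level).
This is the UNSAT statement of the `G₁`-orbit instance «odd FC present» of `oddline.py h G1` (MACHINE: UNSAT at `h = 8, 10`; SAT at `h ≥ 12`). -/
def AbstractOddFree (h : ℤ) : Prop :=
  ∀ vN vP : ACell → Prop, LineModel h vN vP → ∀ X : ACell, AOddFC X → ¬ vN X ∧ ¬ vP X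

/-- the finite check is ANTITONE in the height (models only gain freedom as `h` grows). -/
theorem abstractOddFree_anti {h h' : ℤ} (hle : h ≤ h') (hA : AbstractOddFree h') : AbstractOddFree h :=
  fun vN vP M X hX => hA vN vP (M.mono hle) X hX

/-- a realised cell which is fully charged with an odd pattern comes from an odd fully charged abstract cell. -/
theorem aOddFC_of_realize {h : ℤ} {X : ACell} (hFC : FCc (realize h X)) (hodd : OddPat (realize h X).pat) : AOddFC X := by
  have hc : ∀ f, 1 ≤ (X f).1 := by
    intro f
    by_contra h0
    have h00 : (X f).1 = 0 := by omega
    exact hFC f (by rw [realize_apex (X := X) h00])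
  refine ⟨hc, ?_⟩
  have hb : ∀ f, kbit (realize h X f) = (X f).2.val % 2 := fun f => by
    rw [realize_apply, kbit_lineLetter (hc f)]
  rw [oddPat_iff_pwt] at hodd
  simp only [pwt, bitOf_pat, hb] at hodd
  exact hodd

/-- every cell of an effective LINE-`h` support is a realised abstract cell. -/
theorem exists_realize {h : ℤ} {Z : MCell} (hZ : ∀ f, IsLL h (Z f)) : ∃ X : ACell, realize h X = Z := by
  choose c k hck using hZ
  exact ⟨fun f => (c f, k f), funext fun f => ((hck f).2).symm⟩

/-- **REDUCTION: the finite check at `h` implies (OL_h).** -/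
theorem oddFCFreeLine_of_abstract {h : ℤ} (hA : AbstractOddFree h) : OddFCFreeLine h := by
  intro C hC hG hD hX hodd
  have hM := lineModel_of_config hC hG hD hX
  rcases hodd with ⟨Z, hZ, hFC, hpat⟩ | ⟨P, hP, hFC, hpat⟩
  · obtain ⟨X, rfl⟩ := exists_realize (hC.1 Z hZ)
    exact (hA _ _ hM X (aOddFC_of_realize hFC hpat)).1 hZ
  · obtain ⟨X, rfl⟩ := exists_realize (hC.2 P hP)
    exact (hA _ _ hM X (aOddFC_of_realize hFC hpat)).2 hP

/-- **THE ODD THRESHOLD LAW FROM ONE FINITE CHECK**: `AbstractOddFree 10` (the UNSAT of the LINE-10 `G₁` closed-form instance — MACHINE at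
v1.1, PROVED in Part J: `abstractOddFree_of_lt_twelve`) implies the whole typed law: `(∀ h ≤ 10, OddFCFreeLine h)` by antitonicity and the reduction, `¬ OddFCFreeLine 12` by `Cert12`. -/
theorem oddLineThresholdLaw_of_abstract (h10 : AbstractOddFree 10) : OddLineThresholdLaw :=
  ⟨fun _ hh => oddFCFreeLine_of_abstract (abstractOddFree_anti hh h10), not_oddFCFreeLine_twelve⟩

/-- conversely the SAT side bounds the finite check: `AbstractOddFree h` FAILS for every `h ≥ 12` (PROVED: `Cert12` realises an odd cell, and
the check is antitone). -/
theorem not_abstractOddFree_of_twelve_le {h : ℤ} (hh : 12 ≤ h) : ¬ AbstractOddFree h :=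
  fun hA => not_oddFCFreeLine_twelve (oddFCFreeLine_of_abstract (abstractOddFree_anti hh hA))

/-! ## §D4 The same reduction for the PHASE-TYPE LAW: (PP_h) and (AP_h) from finite checks -/

/-- a charged effective LINE letter determines its charge AND its phase tag. -/
theorem lineLetter_inj {h : ℤ} {c c' : ℕ} {k k' : Fin 4} (hc : 1 ≤ c) (e : lineLetter h c k = lineLetter h c' k') :
    c = c' ∧ k = k' := by
  have hcc := charge_eq_of_lineLetter_eq e
  subst hcc
  refine ⟨rfl, ?_⟩
  fin_cases k <;> fin_cases k' <;> first | rfl | (exfalso; simp [lineLetter, Prod.ext_iff] at e; omega)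

/-- in `Fin 4`: tags of the same parity are equal or antipodal. -/
theorem sameParity_cases : ∀ k₀ k : Fin 4, k.val % 2 = k₀.val % 2 → k = k₀ ∨ k = k₀ + 2 := by
  decide

/-- abstract FULLY CHARGED, NOT ANTIPODAL: all charges `≥ 1` and two tags of different parity. -/
def ANonAntipodalFC (X : ACell) : Prop := (∀ f, 1 ≤ (X f).1) ∧ ∃ f g : Fin 4, (X f).2.val % 2 ≠ (X g).2.val % 2

/-- abstract FULLY CHARGED, NOT PURE: all charges `≥ 1` and two different tags. -/
def ANonPureFC (X : ACell) : Prop := (∀ f, 1 ≤ (X f).1) ∧ ∃ f g : Fin 4, (X f).2 ≠ (X g).2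

/-- **(AAP_h)** the finite check for the antipodal law: no abstract model at height `h` makes a non-antipodal FC cell present
(`oddline.py h G1 nap`; MACHINE: UNSAT at `h = 10` — `L10-G1-nap.cnf` 053540c8c1553b3a, LRAT-checked — SAT at `12`);
PROVED for every `h < 12` in Part K (`abstractAntipodalFC_of_lt_twelve`), refuted for `h ≥ 12` (`not_abstractAntipodalFC_of_twelve_le`). -/
def AbstractAntipodalFC (h : ℤ) : Prop :=
  ∀ vN vP : ACell → Prop, LineModel h vN vP → ∀ X : ACell, ANonAntipodalFC X → ¬ vN X ∧ ¬ vP X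

/-- **(APP_h)** the finite check for the purity law: no abstract model at height `h` makes a non-pure FC cell present
(`oddline.py h G1 mixfc`; MACHINE: UNSAT at `h = 8` — `L8-G1-mixfc.cnf` 34e901b2a9ad6e5a, LRAT-checked — SAT at `10`, type `0022`);
PROVED for every `h < 10` in Part K (`abstractPureFC_of_lt_ten`). -/
def AbstractPureFC (h : ℤ) : Prop :=
  ∀ vN vP : ACell → Prop, LineModel h vN vP → ∀ X : ACell, ANonPureFC X → ¬ vN X ∧ ¬ vP X

/-- `abstractAntipodalFC_anti` (Part D; tree copy, statement verbatim). -/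
theorem abstractAntipodalFC_anti {h h' : ℤ} (hle : h ≤ h') (hA : AbstractAntipodalFC h') : AbstractAntipodalFC h :=
  fun vN vP M X hX => hA vN vP (M.mono hle) X hX

/-- `abstractPureFC_anti` (Part D; tree copy, statement verbatim). -/
theorem abstractPureFC_anti {h h' : ℤ} (hle : h ≤ h') (hA : AbstractPureFC h') : AbstractPureFC h :=
  fun vN vP M X hX => hA vN vP (M.mono hle) X hX

/-- an odd fully charged abstract cell is non-antipodal (four tags of one parity have even parity weight). -/
theorem aNonAntipodal_of_aOdd {X : ACell} (hX : AOddFC X) : ANonAntipodalFC X := by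
  refine ⟨hX.1, ?_⟩
  by_contra hall
  push Not at hall
  have h1 := hall 1 0; have h2 := hall 2 0; have h3 := hall 3 0
  have hodd := hX.2
  rw [h1, h2, h3] at hodd
  omega

/-- a non-antipodal FC abstract cell is non-pure. -/
theorem aNonPure_of_aNonAntipodal {X : ACell} (hX : ANonAntipodalFC X) : ANonPureFC X := by
  obtain ⟨hc, f, g, hfg⟩ := hX
  exact ⟨hc, f, g, fun e => hfg (by rw [e])⟩

/-- the three finite checks are nested: purity ⇒ antipodality ⇒ odd-freeness. -/
theorem abstractAntipodalFC_of_pure {h : ℤ} (hP : AbstractPureFC h) : AbstractAntipodalFC h :=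
  fun vN vP M X hX => hP vN vP M X (aNonPure_of_aNonAntipodal hX)

/-- `abstractOddFree_of_antipodal` (Part D; tree copy, statement verbatim). -/
theorem abstractOddFree_of_antipodal {h : ℤ} (hA : AbstractAntipodalFC h) : AbstractOddFree h :=
  fun vN vP M X hX => hA vN vP M X (aNonAntipodal_of_aOdd hX)

/-- the letters of a fully charged realised cell have charges `≥ 1`. -/
theorem charges_pos_of_fcc {h : ℤ} {X : ACell} (hFC : FCc (realize h X)) : ∀ f, 1 ≤ (X f).1 := by
  intro f
  by_contra h0
  exact hFC f (by rw [realize_apex (X := X) (by omega)])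

/-- **REDUCTION: the finite check (AAP_h) implies (AP_h).** -/
theorem antipodalFCLine_of_abstract {h : ℤ} (hA : AbstractAntipodalFC h) : AntipodalFCLine h := by
  intro C hC hG hD hX Z hZ hFC
  have hM := lineModel_of_config hC hG hD hX
  have hZL : ∀ f, IsLL h (Z f) := by
    rcases Finset.mem_union.mp hZ with h1 | h1
    · exact hC.1 Z h1
    · exact hC.2 Z h1
  obtain ⟨X, rfl⟩ := exists_realize hZL
  have hc := charges_pos_of_fcc hFC
  have hpar : ∀ f g : Fin 4, (X f).2.val % 2 = (X g).2.val % 2 := by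
    intro f g
    by_contra hne
    have hnon : ANonAntipodalFC X := ⟨hc, f, g, hne⟩
    rcases Finset.mem_union.mp hZ with h1 | h1
    · exact (hA _ _ hM X hnon).1 h1
    · exact (hA _ _ hM X hnon).2 h1
  refine ⟨(X 0).2, fun f c k e _ => ?_⟩
  rw [realize_apply] at e
  obtain ⟨-, hk⟩ := lineLetter_inj (hc f) e
  rw [← hk]
  exact sameParity_cases (X 0).2 (X f).2 (hpar f 0)

/-- **REDUCTION: the finite check (APP_h) implies (PP_h).** -/
theorem pureFCLine_of_abstract {h : ℤ} (hA : AbstractPureFC h) : PureFCLine h := by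
  intro C hC hG hD hX Z hZ hFC
  have hM := lineModel_of_config hC hG hD hX
  have hZL : ∀ f, IsLL h (Z f) := by
    rcases Finset.mem_union.mp hZ with h1 | h1
    · exact hC.1 Z h1
    · exact hC.2 Z h1
  obtain ⟨X, rfl⟩ := exists_realize hZL
  have hc := charges_pos_of_fcc hFC
  have heq : ∀ f g : Fin 4, (X f).2 = (X g).2 := by
    intro f g
    by_contra hne
    have hnon : ANonPureFC X := ⟨hc, f, g, hne⟩
    rcases Finset.mem_union.mp hZ with h1 | h1
    · exact (hA _ _ hM X hnon).1 h1
    · exact (hA _ _ hM X hnon).2 h1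
  refine ⟨(X 0).2, fun f c k e _ => ?_⟩
  rw [realize_apply] at e
  obtain ⟨-, hk⟩ := lineLetter_inj (hc f) e
  rw [← hk]
  exact heq f 0

/-- **THE PHASE-TYPE LAW FROM TWO FINITE CHECKS** (`AbstractPureFC 8`: `L8-G1-mixfc` UNSAT; `AbstractAntipodalFC 10`: `L10-G1-nap` UNSAT —
MACHINE; both PROVED in Part K, whence `phaseTypeLaw_holds`). -/
theorem phaseTypeLaw_of_abstract (h8 : AbstractPureFC 8) (h10 : AbstractAntipodalFC 10) : PhaseTypeLaw :=
  ⟨pureFCLine_of_abstract h8, antipodalFCLine_of_abstract h10⟩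

/-- and the SAT sides bound them (PROVED via `Cert12`): no purity or antipodality check holds at any `h ≥ 12`. -/
theorem not_abstractAntipodalFC_of_twelve_le {h : ℤ} (hh : 12 ≤ h) : ¬ AbstractAntipodalFC h :=
  fun hA => not_abstractOddFree_of_twelve_le hh (abstractOddFree_of_antipodal hA)

/-- `not_abstractPureFC_of_twelve_le` (Part D; tree copy, statement verbatim). -/
theorem not_abstractPureFC_of_twelve_le {h : ℤ} (hh : 12 ≤ h) : ¬ AbstractPureFC h :=
  fun hP => not_abstractAntipodalFC_of_twelve_le hh (abstractAntipodalFC_of_pure hP)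

end Summit.Ventures.HSemireg.Pad4Tower.LinePhaseRigidity
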